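import Summits.BirchSwinnertonDyer.BirchSwinnertonDyer.Theorems.QuadraticBranchSignedControlPlusEtaNonsurjMinusCoeffCongruence
import Mathlib.RingTheory.Polynomial.Eisenstein.IsIntegral
import HarnessLib

/-!
# Route `QuadraticBranchSignedControl` (rung K8, cell `bsd-potss`), residual crux `PlusEtaMainConjectureNonsurj`
# (stmt-BirchSwinnertonDyer-19606): THE θ-COEFFICIENT CONGRUENCE FOR THE HIGHER COEFFICIENTS `coeff_k L_p⁻(V, η, X)`, `k < p` — the
# unitriangular system `coeff_kθ_{2m+1}(η) ≡ (−1)^{m+1} Σ_{s+t=k} (ω⁺_{2m+1})_s · coeff_t M (mod p^{2m+1})`, `(ω⁺)_0 = p^m`, `p^m ∣ (ω⁺)_s`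
# (seat `bsd-potss-k8eta-c2` g24; sequel of `…MinusCoeffCongruence.lean`, the algebra behind «MT-C1 stage 3 is unnecessary» of the g24 memo)

WHY. `…MinusCoeffCongruence` reads `coeff₁`. The λ-invariant of `L_p⁻(V,η,X)` (displayed as PARI's `λ⁻` in every record of the crux; the census laws
of g19/g22 are stated in it) and g23's higher readings `c_k ≡ R_k (mod p^{(NMAX+1)/2})`, `k ≤ p−1`, need ALL `coeff_k`, `k < p`. THIS FILE proves the
triangular congruences that make them finite symbol data: with `M` the odd-level Mazur–Tate limit, `Θ − (−1)^{m+1}ω⁺_{2m+1}M = ω_{2m+1}q` in `Λ`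
(prequel), and for `k < p`: (i) `p^{2m+1} ∣ (ω_{2m+1})_s` for `0 < s < p` (`(ω_n)_s = C(pⁿ,s)`, `s·C(pⁿ,s) = pⁿ·C(pⁿ−1,s−1)`, `p ∤ s`), `(ω_n)_0 = 0`;
(ii) `(ω⁺_{2m+1})_0 = p^m` and `p^m ∣ (ω⁺_{2m+1})_s` for `0 < s < p(p−1)` (each factor `Φ_{p^{2i}}(1+X)` is Eisenstein at `p` —
Mathlib `cyclotomic_prime_pow_comp_X_add_one_isEisensteinAt` — of degree `≥ p(p−1)`); hence
(iii) `coeff_kθ_{2m+1}(η) = (−1)^{m+1} Σ_{(s,t), s+t=k} (ω⁺_{2m+1})_s·coeff_tM + p^{2m+1}·r_k`, a unitriangular system (diagonal `p^m`) that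
determines `coeff_kM mod p^{m+1}` from the `k+1` rationals `coeff_jθ_{2m+1}(η)`, `j ≤ k` — and `coeff_kL = v·ϖ·coeff_kM` for every minus branch
function `L` (`exists_units_forall_coeff_eq`). Readings of `λ⁻ < p` from symbols are then bookkeeping over this system (left to the consumer / a sequel).

WHAT. §8 `prime_pow_dvd_choose_prime_pow`, `coeff_cyclotomicOmega_of_pos`, `pow_succ_dvd_coeff_mul`, `pow_dvd_coeff_prod_range`,
`dvd_coeff_cyclotomic_comp_X_add_one_of_lt`, `pow_dvd_coeff_cyclotomicOmegaPlus_two_mul_add_one`; §9 `exists_units_forall_coeff_eq` (all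
coefficients at once), `exists_coeff_mazurTate_eq_sum` (the triangular identity for `M`).

HONEST FRAMING (cell `bsd-potss`; FULL-BSD rank ≤ 1 programme, HUMAN RULING D-0036/D-0074): TOOL THEOREMS ONLY — no definition, no named fact,
no `sorry`, axioms standard; nothing about (A), (C1⁺_η), C-cc-1 or `BSD(W,p)` of any pair is claimed; no stub of 19606 is proved; crux and route
OPEN; nothing booked. `--supports stmt-BirchSwinnertonDyer-19606`.

References: [Pollack2003] Prop. 6.18, §6.5; [Kobayashi2003] Thm. 3.2, (3.5), (3.7) (p. 7); [MazurTateTeitelbaum1986Invent] §I.13; [Washington1997] §7.1.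
-/

set_option autoImplicit false
set_option linter.dupNamespace false
noncomputable section

open scoped Classical MatrixGroups ModularForm

open CongruenceSubgroup Polynomial Literature.NumberTheory.EllipticCurves
  Literature.NumberTheory.EllipticCurves.ModularForms
open Summit.BirchSwinnertonDyer.Rank1Residual.Additive

namespace Summit.BirchSwinnertonDyer.BirchSwinnertonDyer.Theorems.EtaMinusCoeffCongruence

variable {p : ℕ} [hp : Fact p.Prime]

/-! ## §8 Low coefficients of `ω_n` and `ω⁺_{2m+1}` -/

/-- `p^N ∣ C(p^N, s)` for `0 < s < p` (`s·C(p^N,s) = p^N·C(p^N−1,s−1)` and `gcd(p, s) = 1`). [folklore] -/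
theorem prime_pow_dvd_choose_prime_pow {s : ℕ} (N : ℕ) (hs0 : 0 < s) (hsp : s < p) : p ^ N ∣ (p ^ N).choose s := by
  have hP := hp.out
  obtain ⟨s', rfl⟩ : ∃ s', s = s' + 1 := ⟨s - 1, by omega⟩
  have h := Nat.add_one_mul_choose_eq (p ^ N - 1) s'
  have hpn : p ^ N - 1 + 1 = p ^ N := Nat.sub_add_cancel (Nat.one_le_pow _ _ hP.pos)
  rw [hpn] at h
  have hcop : Nat.Coprime (p ^ N) (s' + 1) := by
    refine Nat.Coprime.pow_left N ((Nat.Prime.coprime_iff_not_dvd hP).mpr fun hd ↦ ?_)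
    exact absurd (Nat.le_of_dvd (Nat.succ_pos s') hd) (by omega)
  exact hcop.dvd_of_dvd_mul_right ⟨(p ^ N - 1).choose s', h.symm⟩

omit hp in
/-- `(ω_n)_s = C(pⁿ, s)` for `s > 0` (`ω_n = (1+X)^{pⁿ} − 1`). [cite: Pollack2003, §6.5 (display before Prop. 6.18)] -/
theorem coeff_cyclotomicOmega_of_pos (n : ℕ) {s : ℕ} (hs : 0 < s) :
    (cyclotomicOmega p n).coeff s = ((p ^ n).choose s : ℤ) := by
  rw [cyclotomicOmega, coeff_sub, coeff_X_add_one_pow, coeff_one, if_neg (by omega), sub_zero]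

omit hp in
/-- One more factor with low coefficients in `(p)` raises the `p`-power dividing the low coefficients of a product by one:
`p^r ∣ P_j`, `p ∣ Q_j` (`j < D`) give `p^{r+1} ∣ (PQ)_j` (`j < D`). [folklore] -/
theorem pow_succ_dvd_coeff_mul {D r : ℕ} {P Q : ℤ[X]} (hP : ∀ j < D, (p : ℤ) ^ r ∣ P.coeff j)
    (hQ : ∀ j < D, (p : ℤ) ∣ Q.coeff j) : ∀ j < D, (p : ℤ) ^ (r + 1) ∣ (P * Q).coeff j := by
  intro j hj
  rw [coeff_mul]
  refine Finset.dvd_sum fun x hx ↦ ?_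
  obtain ⟨a, b⟩ := x
  have hab : a + b = j := Finset.HasAntidiagonal.mem_antidiagonal.mp hx
  rw [pow_succ]
  exact mul_dvd_mul (hP a (by omega)) (hQ b (by omega))

omit hp in
/-- `p^m` divides the coefficients below `D` of a product of `m` polynomials whose coefficients below `D` lie in `(p)`. [folklore] -/
theorem pow_dvd_coeff_prod_range {D : ℕ} (G : ℕ → ℤ[X]) (hG : ∀ i, ∀ j < D, (p : ℤ) ∣ (G i).coeff j) :
    ∀ m, ∀ j < D, (p : ℤ) ^ m ∣ (∏ i ∈ Finset.range m, G i).coeff j := by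
  intro m
  induction m with
  | zero => intro j _; rw [pow_zero]; exact one_dvd _
  | succ m ih =>
    intro j hj
    rw [Finset.prod_range_succ]
    exact pow_succ_dvd_coeff_mul ih (hG m) j hj

/-- The coefficients of `Φ_{p^{e+2}}(1+X)` below degree `p(p−1)` lie in `(p)` (Eisenstein at `p`, degree `p^{e+1}(p−1) ≥ p(p−1)`).
[cite: Washington1997, §7.1] -/
theorem dvd_coeff_cyclotomic_comp_X_add_one_of_lt (e : ℕ) :
    ∀ j < p * (p - 1), (p : ℤ) ∣ ((cyclotomic (p ^ (e + 2)) ℤ).comp (X + 1)).coeff j := by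
  intro j hj
  have hP := hp.out
  have hE := cyclotomic_prime_pow_comp_X_add_one_isEisensteinAt p (e + 1)
  have hdeg : ((cyclotomic (p ^ (e + 2)) ℤ).comp (X + 1)).natDegree = p ^ (e + 1) * (p - 1) := by
    rw [natDegree_comp, natDegree_cyclotomic, Nat.totient_prime_pow hP (by omega),
      show (X + 1 : ℤ[X]) = X + C 1 by rw [C_1], natDegree_X_add_C, mul_one, show e + 2 - 1 = e + 1 from rfl]
  have hle : p * (p - 1) ≤ p ^ (e + 1) * (p - 1) :=
    Nat.mul_le_mul_right _ (by rw [pow_succ]; exact Nat.le_mul_of_pos_left p (pow_pos hP.pos e))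
  have hlt : j < ((cyclotomic (p ^ (e + 2)) ℤ).comp (X + 1)).natDegree := by rw [hdeg]; omega
  have hmem := hE.mem hlt
  exact Ideal.mem_span_singleton.mp hmem

/-- **`p^m ∣ (ω⁺_{2m+1})_j` for every `j < p(p−1)`** (`ω⁺_{2m+1} = ∏_{i<m} Φ_{p^{2i+2}}(1+X)`; in particular `(ω⁺_{2m+1})_0 = p^m` exactly,
`coeff_zero_cyclotomicOmegaPlus_two_mul_add_one`). [cite: Pollack2003, §6.5 (display before Prop. 6.18)] -/
theorem pow_dvd_coeff_cyclotomicOmegaPlus_two_mul_add_one (m : ℕ) :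
    ∀ j < p * (p - 1), (p : ℤ) ^ m ∣ (cyclotomicOmegaPlus p (2 * m + 1)).coeff j := by
  rw [cyclotomicOmegaPlus_two_mul_add_one, cyclotomicOmegaPlus_two_mul_eq_prod]
  exact pow_dvd_coeff_prod_range (fun i ↦ (cyclotomic (p ^ (2 * i + 2)) ℤ).comp (X + 1))
    (fun i ↦ dvd_coeff_cyclotomic_comp_X_add_one_of_lt (2 * i)) m

/-! ## §9 All coefficients at once: `coeff_k L = v·ϖ·coeff_k M` and the triangular identity for `coeff_k M`, `k < p` -/

section MazurTate

variable {N : ℕ} [NeZero N] {f : CuspForm (Gamma0 N) 2}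

/-- **Every minus branch function is `v · ϖ · M` coefficient by coefficient** (all `k` at once; `‖ϖ‖_p ≤ 1`; x1b's uniqueness).
[cite: Kobayashi2003, Thm. 3.2 and (3.5) (p. 7)] [cite: Pollack2003, Prop. 6.18] -/
theorem exists_units_forall_coeff_eq (hp2 : p ≠ 2) (hf0 : IsNewform0 f) (hQ : coeffField f = ⊥)
    (hpN : ¬ p ∣ N) (hap : cuspCoeff f p = ((0 : ℤ) : ℂ)) {ϖ : ℚ} (hϖ : ‖(ϖ : ℚ_[p])‖ ≤ 1)
    {L M : IwasawaAlgebra p} (hL : IsQuadraticBranchMinusLFunction f p ϖ L)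
    (hM : ∀ m : ℕ, IsCongrModOmega p (2 * m + 1) (quadraticBranchMazurTateElement p f (2 * m + 1))
      ((-1) ^ (m + 1) * cyclotomicOmegaPlus p (2 * m + 1)) M) :
    ∃ v : ℤ_[p]ˣ, ∀ k : ℕ, ((PowerSeries.coeff k L : ℤ_[p]) : ℚ_[p]) =
      ((v : ℤ_[p]) : ℚ_[p]) * ((ϖ : ℚ_[p]) * ((PowerSeries.coeff k M : ℤ_[p]) : ℚ_[p])) := by
  set c : ℤ_[p] := ⟨(ϖ : ℚ_[p]), hϖ⟩ with hc_def
  have hcϖ : ((c : ℤ_[p]) : ℚ_[p]) = (ϖ : ℚ_[p]) := rfl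
  have h1 := isQuadraticBranchMinusLFunction_one_of_isCongrModOmega hp2 hf0 hQ hpN hap hM
  have h2 := isQuadraticBranchMinusLFunction_C_mul h1 c ϖ hcϖ
  rw [mul_one] at h2
  obtain ⟨v, hv⟩ := h2.exists_units_smul_eq hp2 hL
  refine ⟨v, fun k ↦ ?_⟩
  rw [hv, PowerSeries.coeff_smul, PowerSeries.coeff_C_mul, smul_eq_mul, PadicInt.coe_mul, PadicInt.coe_mul, hcϖ]

/-- **THE TRIANGULAR IDENTITY for `coeff_k M`, `k < p`.** If `M ∈ Λ` satisfies `θ_{2m+1}(η) ≡ (−1)^{m+1}ω⁺_{2m+1}M (mod ω_{2m+1})` then for every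
`k < p` there is `r ∈ ℤ_p` with
`coeff_kθ_{2m+1}(η) = (−1)^{m+1} Σ_{(s,t) : s+t=k} (ω⁺_{2m+1})_s · coeff_tM + p^{2m+1}·r` in `ℚ_p` — the `ω_{2m+1}q` term contributes `p^{2m+1}r` because
`(ω_{2m+1})_0 = 0` and `p^{2m+1} ∣ (ω_{2m+1})_s = C(p^{2m+1},s)` for `0 < s ≤ k < p`. With `(ω⁺)_0 = p^m` and `p^m ∣ (ω⁺)_s` (§8) this is a
unitriangular system for the `coeff_tM mod p^{m+1}`, `t ≤ k`. [cite: Pollack2003, Prop. 6.18] [cite: MazurTateTeitelbaum1986Invent, §I.13] -/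
theorem exists_coeff_mazurTate_eq_sum (hp2 : p ≠ 2) (hf0 : IsNewform0 f) (hQ : coeffField f = ⊥)
    (hpN : ¬ p ∣ N) (hap : cuspCoeff f p = ((0 : ℤ) : ℂ)) (m : ℕ) {k : ℕ} (hk : k < p) {M : IwasawaAlgebra p}
    (hM : IsCongrModOmega p (2 * m + 1) (quadraticBranchMazurTateElement p f (2 * m + 1))
      ((-1) ^ (m + 1) * cyclotomicOmegaPlus p (2 * m + 1)) M) :
    ∃ r : ℤ_[p], (((quadraticBranchMazurTateElement p f (2 * m + 1)).coeff k : ℚ) : ℚ_[p]) =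
      (-1) ^ (m + 1) * (∑ x ∈ Finset.HasAntidiagonal.antidiagonal k,
        (((cyclotomicOmegaPlus p (2 * m + 1)).coeff x.1 : ℤ) : ℚ_[p]) * ((PowerSeries.coeff x.2 M : ℤ_[p]) : ℚ_[p])) +
        (p : ℚ_[p]) ^ (2 * m + 1) * (r : ℚ_[p]) := by
  obtain ⟨Θ, q, hΘ, hid⟩ := exists_sub_eq_omega_mul_of_isCongrModOmega hp2 hf0 hQ hpN hap hM
  set ωp : ℤ_[p][X] := ((-1) ^ (m + 1) * cyclotomicOmegaPlus p (2 * m + 1)).map (Int.castRingHom ℤ_[p]) with hωp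
  set Ω : ℤ_[p][X] := (cyclotomicOmega p (2 * m + 1)).map (Int.castRingHom ℤ_[p]) with hΩ
  -- the `ω_n q` term is divisible by `p^n` in degree `k`
  have hΩdvd : ∀ s ≤ k, (p : ℤ_[p]) ^ (2 * m + 1) ∣ Ω.coeff s := by
    intro s hs
    rcases Nat.eq_zero_or_pos s with rfl | hs0
    · rw [hΩ, Polynomial.coeff_map, coeff_zero_cyclotomicOmega, map_zero]
      exact dvd_zero _
    · rw [hΩ, Polynomial.coeff_map, coeff_cyclotomicOmega_of_pos _ hs0, map_natCast]
      have h := Nat.cast_dvd_cast (α := ℤ_[p]) (prime_pow_dvd_choose_prime_pow (p := p) (2 * m + 1) hs0 (by omega))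
      push_cast at h
      exact h
  have hdvd : (p : ℤ_[p]) ^ (2 * m + 1) ∣ PowerSeries.coeff k ((Ω : PowerSeries ℤ_[p]) * q) := by
    rw [PowerSeries.coeff_mul]
    refine Finset.dvd_sum fun x hx ↦ ?_
    have hx' : x.1 + x.2 = k := Finset.HasAntidiagonal.mem_antidiagonal.mp hx
    rw [Polynomial.coeff_coe]
    exact Dvd.dvd.mul_right (hΩdvd x.1 (by omega)) _
  obtain ⟨r, hr⟩ := hdvd
  refine ⟨r, ?_⟩
  -- the `ω⁺ M` term
  have hωcoeff : ∀ s, ωp.coeff s = (-1) ^ (m + 1) * (((cyclotomicOmegaPlus p (2 * m + 1)).coeff s : ℤ) : ℤ_[p]) := by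
    intro s
    rw [hωp, Polynomial.coeff_map, show ((-1 : ℤ[X]) ^ (m + 1)) = C ((-1 : ℤ) ^ (m + 1)) by simp, coeff_C_mul]
    simp
  have h1 := congrArg (PowerSeries.coeff k) hid
  rw [map_sub, hr, PowerSeries.coeff_mul, Polynomial.coeff_coe] at h1
  simp only [Polynomial.coeff_coe, hωcoeff] at h1
  have hΘk : Θ.coeff k = (-1) ^ (m + 1) * (∑ x ∈ Finset.HasAntidiagonal.antidiagonal k,
      (((cyclotomicOmegaPlus p (2 * m + 1)).coeff x.1 : ℤ) : ℤ_[p]) * PowerSeries.coeff x.2 M) +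
      (p : ℤ_[p]) ^ (2 * m + 1) * r := by
    rw [Finset.mul_sum]
    have : ∑ x ∈ Finset.HasAntidiagonal.antidiagonal k, (-1) ^ (m + 1) *
        ((((cyclotomicOmegaPlus p (2 * m + 1)).coeff x.1 : ℤ) : ℤ_[p]) * PowerSeries.coeff x.2 M) =
        ∑ x ∈ Finset.HasAntidiagonal.antidiagonal k, (-1) ^ (m + 1) * (((cyclotomicOmegaPlus p (2 * m + 1)).coeff x.1 : ℤ) : ℤ_[p]) *
          PowerSeries.coeff x.2 M := Finset.sum_congr rfl fun x _ ↦ by ring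
    rw [this]
    linear_combination h1
  have hc := congrArg (fun P : ℚ_[p][X] ↦ P.coeff k) hΘ
  simp only [Polynomial.coeff_map, eq_ratCast] at hc
  rw [← hc, hΘk]
  simp only [map_add, map_mul, map_sum, map_pow, map_neg, map_one, map_natCast, map_intCast,
    PadicInt.algebraMap_apply]

end MazurTate

end Summit.BirchSwinnertonDyer.BirchSwinnertonDyer.Theorems.EtaMinusCoeffCongruence

end
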